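import Summits.BirchSwinnertonDyer.Rank1Residual.Additive.TameBranchOneValueLaw
import Summits.BirchSwinnertonDyer.Rank1Residual.Iwasawa.LambdaInvariantValuationTwisted
import HarnessLib

/-!
# The one-value law ON A LAYER (`(p‖τ‖‖S(κ)‖)^{φ(pⁿ⁺¹)} = (p^c)^{φ}·p^{−λ_an}`, both ways) and the
# two conjugate Gauss sums made explicit by STICKELBERGER (`ord_p τ ∈ {1 − 1/e, 1/e}`)
# (cell `b2b-bsdres`, sub-cell additive-p2 = X3♯(G-ord)/X4♯(G-ord), gen 27; part 2/4)

HONEST FRAMING (cell `b2b-bsdres`, run/shared/lean/b2b/bsd-rank1-residual/, verbatim in every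
file): the goal of the cell is to DELETE the COMBINATION-SHAPED residual classes of the
Birch–Swinnerton-Dyer formula for ALL analytic-rank `≤ 1` elliptic curves over `ℚ` — "full BSD
formula for every rank `≤ 1` curve in class `C`" assembled STRICTLY from published theorems — so
that the rank-`≤ 1` remainder becomes exactly the CONSTRUCTION-SHAPED classes, which are TYPED
(missing-input `Prop`s), NOT attempted. This is not "finishing BSD". Sub-cell additive-p2: the
classes X3♯(G-ord) / X4♯(G-ord) are CONSTRUCTION-SHAPED and stay so; labels / RESIDUAL-MAP marks
UNCHANGED; nothing is booked. THEOREMS ONLY; no definition, no named fact, no `sorry`.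

## What

Part 1 (`TameBranchOneValueLaw.lean`) proved, for EVERY witness `B` of `IsTameBranchOf f p ε α B`
(`‖α‖ = 1`, coefficient bound `p^c`) and one even primitive wild `κ` of conductor `p^m`:
`p‖τ(ε,ψ_κ)‖‖S(κ)‖ = p^c‖κ(γ)−1‖^k` iff `‖[T^k]B‖ = p^c` is the FIRST coefficient at the bound
(`‖κ(γ)−1‖^k > p⁻¹`). Here:

* §3 LAYER FORM (conductor `p^{n+1+e₀}`; `κ(γ)` has order `pⁿ⁺¹`, `‖κ(γ)−1‖^{φ(pⁿ⁺¹)} = p⁻¹` —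
  additive-p3's `Iwasawa.norm_sub_one_pow_totient_eq`): for `k < φ(pⁿ⁺¹)`,
  **`(p‖τ(ε,ψ_κ)‖‖S(κ)‖)^{φ(pⁿ⁺¹)} = (p^c)^{φ(pⁿ⁺¹)}·p^{−k}` ⟺ first top coefficient at `k`**
  (`IsTameBranchOf.pow_totient_eq_of_firstTop`, `IsTameBranchOf.firstTop_of_pow_totient_eq`), the
  existence form (`p‖τ‖‖S‖ > p^{c−1}` ⟹ such a `k < φ` exists) and the undetermined regime
  (`p‖τ‖‖S‖ ≤ p^{c−1} ↔ ∀ j < φ, ‖[T^j]B‖ < p^c`).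
* §4 STICKELBERGER makes `‖τ‖` explicit for `ε = ι∘χ`, `χ : (ℤ/p)^× → ℚ_p` of order `e ≥ 2`,
  `eu = p − 1`: `χ = ω^u` (Teichmüller power of the SMALL exponent; the UNSTARRED Kodaira types
  II/III/IV carry this bounded character) ⟹ `‖τ(ι∘χ,ψ_κ)‖^e = p^{−(e−1)}`
  (`norm_tameGaussSum_pow_eq_of_teichmullerPow`); `χ = ω^{(e−1)u}` (STARRED types) ⟹
  `‖τ(ι∘χ,ψ_κ)‖^e = p⁻¹` (`…teichmullerPow'`); `‖τ(ε)‖‖τ(ε⁻¹)‖ = p⁻¹`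
  (`norm_tameGaussSum_mul_norm_tameGaussSum_inv`, from `τ(ε)τ(ε̄) = ε(−1)p`) and hence for `χ = ω^u`:
  `‖τ(ι∘χ⁻¹,ψ_κ)‖^e = p⁻¹` (`norm_tameGaussSum_inv_pow_eq_of_teichmullerPow`) — the two CONJUGATE
  characters of order `e ∈ {3,4,6}` have Gauss sums of different absolute value.
  Part 3 (`TameBranchOneValueStickelberger.lean`) combines §3 and §4 into the explicit law
  `ord_p S(κ) = λ_an/φ + [1/e ∣ 1 − 1/e] − c` (both ways) and reads the SIGN off the same value;
  part 4 (`TameBranchOneValueCertificateJoin.lean`) feeds the certificate into `CharLamLeAt`.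

Not claimed: which character carries a witness (part 3 decides it from print); anything booked.

References: Mazur–Tate–Teitelbaum 1986 §I.8, §I.13–I.14 [MazurTateTeitelbaum1986Invent];
Washington GTM 83 §7.1–7.2 [Washington1997]; Lang, *Cyclotomic Fields I–II*, Ch. 1 §2 Thm. 2.1
(Stickelberger) [Lang1990]; HOME/b2b-bsdres-additive-p2/gen26/GAUSSCERT-CHECK.md, GAUSSCERT3-RESULT.md. -/

set_option autoImplicit false

noncomputable section

open scoped Classical MatrixGroups ModularForm NumberField Topology

open CongruenceSubgroup IsDedekindDomain WeierstrassCurve NumberField Filter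
  Literature.NumberTheory.EllipticCurves
  Literature.NumberTheory.EllipticCurves.ModularForms
  Literature.NumberTheory.EllipticCurves.Rank1Residual
  Literature.NumberTheory.GaussSums

namespace Summit.BirchSwinnertonDyer.Rank1Residual.Additive

/-! ### §3 Layer form: conductor `p^{n+1+e₀}`, `‖κ(γ) − 1‖^{φ(pⁿ⁺¹)} = p⁻¹` -/

section Layer

open TameBranchOneValue

variable {p : ℕ} [hp : Fact p.Prime] {N : ℕ} {f : CuspForm (Gamma0 N) 2}

omit hp in
/-- `2 ≤ n + 1 + e₀` (`e₀ = cyclotomicExponent p ∈ {1, 2}`). [folklore] -/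
theorem two_le_add_one_add_cyclotomicExponent (n : ℕ) : 2 ≤ n + 1 + cyclotomicExponent p := by
  unfold cyclotomicExponent
  split_ifs <;> omega

/-- **THE LAW (layer form): `ord_p S(κ) = λ_an/φ(pⁿ⁺¹) + 1 − ord_p τ(ε,ψ_κ) + μ_an`.** For EVERY
witness `B` of `IsTameBranchOf f p ε α B` (`‖α‖ = 1`, coefficient bound `p^c`, first top coefficient
at `k`) and every even primitive `p`-power-order `κ` of conductor `p^{n+1+e₀}` with `k < φ(pⁿ⁺¹)`:
**`(p·‖τ(ε,ψ_κ)‖·‖Σ_b κ(b)[b/p^{n+1+e₀}]⁺_f‖)^{φ(pⁿ⁺¹)} = (p^c)^{φ(pⁿ⁺¹)}·p^{−k}`**.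
[cite: MazurTateTeitelbaum1986Invent, §I.8, §I.13–I.14] [cite: Washington1997, §7.1–7.2 and Thm. 7.3 (shape)] -/
theorem IsTameBranchOf.pow_totient_eq_of_firstTop
    {ε : DirichletCharacter ℂ_[p] p} {α : ℚ_[p]} {B : PowerSeries ℚ_[p]}
    (h : IsTameBranchOf f p ε α B) (hα : ‖α‖ = 1) {c : ℕ}
    (hbd : ∀ j : ℕ, ‖PowerSeries.coeff j B‖ ≤ (p : ℝ) ^ c)
    {k : ℕ} (hk : ‖PowerSeries.coeff k B‖ = (p : ℝ) ^ c)
    (hlt : ∀ i < k, ‖PowerSeries.coeff i B‖ < (p : ℝ) ^ c)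
    {n : ℕ} {κ : DirichletCharacter ℂ_[p] (p ^ (n + 1 + cyclotomicExponent p))} (hκ : κ.IsPrimitive)
    (heven : κ.Even) (hord : ∃ j : ℕ, orderOf κ = p ^ j) (hkφ : k < Nat.totient (p ^ (n + 1))) :
    ((p : ℝ) * ‖tameGaussSum p ε κ‖ * ‖ratTwistedSymbolSum f κ‖) ^ Nat.totient (p ^ (n + 1)) =
      ((p : ℝ) ^ c) ^ Nat.totient (p ^ (n + 1)) * ((p : ℝ)⁻¹) ^ k := by
  have hζ := Iwasawa.isPrimitiveRoot_apply_cyclotomicGenerator κ hκ heven hord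
  have hzk := (Iwasawa.inv_lt_norm_sub_one_pow_iff hζ k).mpr hkφ
  rw [h.mul_norm_tameGaussSum_mul_norm_eq_of_firstTop hα hbd hk hlt
      (two_le_add_one_add_cyclotomicExponent n) hκ heven hord hzk, mul_pow,
    pow_right_comm _ k (Nat.totient (p ^ (n + 1))), Iwasawa.norm_sub_one_pow_totient_eq hζ]

/-- **THE ONE-VALUE CERTIFICATE (layer form).** For EVERY witness `B` of `IsTameBranchOf f p ε α B`
(`‖α‖ = 1`, coefficient bound `p^c`), ONE even primitive `p`-power-order `κ` of conductor `p^{n+1+e₀}`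
and `k < φ(pⁿ⁺¹)` with **`(p·‖τ(ε,ψ_κ)‖·‖S(κ)‖)^{φ(pⁿ⁺¹)} = (p^c)^{φ(pⁿ⁺¹)}·p^{−k}`** give
**`‖[T^k]B‖ = p^c`, all earlier coefficients `< p^c`** (`λ_an = k` at the bound).
[cite: MazurTateTeitelbaum1986Invent, §I.8, §I.13–I.14] [cite: Washington1997, §7.1–7.2 and Thm. 7.3 (shape)] -/
theorem IsTameBranchOf.firstTop_of_pow_totient_eq
    {ε : DirichletCharacter ℂ_[p] p} {α : ℚ_[p]} {B : PowerSeries ℚ_[p]}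
    (h : IsTameBranchOf f p ε α B) (hα : ‖α‖ = 1) {c : ℕ}
    (hbd : ∀ j : ℕ, ‖PowerSeries.coeff j B‖ ≤ (p : ℝ) ^ c)
    {n : ℕ} {κ : DirichletCharacter ℂ_[p] (p ^ (n + 1 + cyclotomicExponent p))} (hκ : κ.IsPrimitive)
    (heven : κ.Even) (hord : ∃ j : ℕ, orderOf κ = p ^ j) {k : ℕ} (hkφ : k < Nat.totient (p ^ (n + 1)))
    (hval : ((p : ℝ) * ‖tameGaussSum p ε κ‖ * ‖ratTwistedSymbolSum f κ‖) ^ Nat.totient (p ^ (n + 1)) =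
      ((p : ℝ) ^ c) ^ Nat.totient (p ^ (n + 1)) * ((p : ℝ)⁻¹) ^ k) :
    ‖PowerSeries.coeff k B‖ = (p : ℝ) ^ c ∧ ∀ i < k, ‖PowerSeries.coeff i B‖ < (p : ℝ) ^ c := by
  have hζ := Iwasawa.isPrimitiveRoot_apply_cyclotomicGenerator κ hκ heven hord
  have hzk := (Iwasawa.inv_lt_norm_sub_one_pow_iff hζ k).mpr hkφ
  have hφ : Nat.totient (p ^ (n + 1)) ≠ 0 := (Nat.totient_pos.mpr (pow_pos hp.out.pos _)).ne'
  have hval' : (p : ℝ) * ‖tameGaussSum p ε κ‖ * ‖ratTwistedSymbolSum f κ‖ =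
      (p : ℝ) ^ c * ‖κ (cyclotomicGenerator p : ZMod (p ^ (n + 1 + cyclotomicExponent p))) - 1‖ ^ k := by
    refine (pow_left_inj₀ (by positivity) (by positivity) hφ).mp ?_
    rw [hval, mul_pow, pow_right_comm _ k (Nat.totient (p ^ (n + 1))),
      Iwasawa.norm_sub_one_pow_totient_eq hζ]
  exact h.firstTop_of_mul_norm_tameGaussSum_mul_norm_eq hα hbd (two_le_add_one_add_cyclotomicExponent n)
    hκ heven hord hzk hval'

/-- **ONE VALUE above `p^{c−1}` locates `λ_an < φ(pⁿ⁺¹)`** (layer form): if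
`p·‖τ(ε,ψ_κ)‖·‖S(κ)‖ > p^{c−1}` at conductor `p^{n+1+e₀}` then for some `k < φ(pⁿ⁺¹)`:
`‖[T^k]B‖ = p^c` is the first top coefficient and `(p‖τ‖‖S(κ)‖)^{φ} = (p^c)^{φ}·p^{−k}`.
[cite: MazurTateTeitelbaum1986Invent, §I.8, §I.13–I.14] [cite: Washington1997, §7.1–7.2 and Thm. 7.3 (shape)] -/
theorem IsTameBranchOf.exists_firstTop_lt_totient_of_lt
    {ε : DirichletCharacter ℂ_[p] p} {α : ℚ_[p]} {B : PowerSeries ℚ_[p]}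
    (h : IsTameBranchOf f p ε α B) (hα : ‖α‖ = 1) {c : ℕ}
    (hbd : ∀ j : ℕ, ‖PowerSeries.coeff j B‖ ≤ (p : ℝ) ^ c)
    {n : ℕ} {κ : DirichletCharacter ℂ_[p] (p ^ (n + 1 + cyclotomicExponent p))} (hκ : κ.IsPrimitive)
    (heven : κ.Even) (hord : ∃ j : ℕ, orderOf κ = p ^ j)
    (hgt : (p : ℝ) ^ c * (p : ℝ)⁻¹ <
      (p : ℝ) * ‖tameGaussSum p ε κ‖ * ‖ratTwistedSymbolSum f κ‖) :
    ∃ k : ℕ, k < Nat.totient (p ^ (n + 1)) ∧ ‖PowerSeries.coeff k B‖ = (p : ℝ) ^ c ∧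
      (∀ i < k, ‖PowerSeries.coeff i B‖ < (p : ℝ) ^ c) ∧
      ((p : ℝ) * ‖tameGaussSum p ε κ‖ * ‖ratTwistedSymbolSum f κ‖) ^ Nat.totient (p ^ (n + 1)) =
        ((p : ℝ) ^ c) ^ Nat.totient (p ^ (n + 1)) * ((p : ℝ)⁻¹) ^ k := by
  have hζ := Iwasawa.isPrimitiveRoot_apply_cyclotomicGenerator κ hκ heven hord
  obtain ⟨k, hzk, hk, hlt, -⟩ := h.exists_firstTop_of_lt_mul_norm_tameGaussSum_mul_norm hα hbd
    (two_le_add_one_add_cyclotomicExponent n) hκ heven hord hgt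
  have hkφ := (Iwasawa.inv_lt_norm_sub_one_pow_iff hζ k).mp hzk
  exact ⟨k, hkφ, hk, hlt, h.pow_totient_eq_of_firstTop hα hbd hk hlt hκ heven hord hkφ⟩

/-- **The undetermined regime (layer form)**: `p·‖τ(ε,ψ_κ)‖·‖S(κ)‖ ≤ p^{c−1}` at conductor
`p^{n+1+e₀}` iff `‖[T^j]B‖ < p^c` for EVERY `j < φ(pⁿ⁺¹)` ("`μ_an ≥ 1` or `λ_an ≥ φ(pⁿ⁺¹)`" relative
to the bound — then a higher conductor is needed). [cite: MazurTateTeitelbaum1986Invent, §I.8, §I.13–I.14]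
[cite: Washington1997, §7.1–7.2 and Thm. 7.3 (shape)] -/
theorem IsTameBranchOf.mul_norm_tameGaussSum_mul_norm_le_iff_forall_lt_totient
    {ε : DirichletCharacter ℂ_[p] p} {α : ℚ_[p]} {B : PowerSeries ℚ_[p]}
    (h : IsTameBranchOf f p ε α B) (hα : ‖α‖ = 1) {c : ℕ}
    (hbd : ∀ j : ℕ, ‖PowerSeries.coeff j B‖ ≤ (p : ℝ) ^ c)
    {n : ℕ} {κ : DirichletCharacter ℂ_[p] (p ^ (n + 1 + cyclotomicExponent p))} (hκ : κ.IsPrimitive)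
    (heven : κ.Even) (hord : ∃ j : ℕ, orderOf κ = p ^ j) :
    (p : ℝ) * ‖tameGaussSum p ε κ‖ * ‖ratTwistedSymbolSum f κ‖ ≤ (p : ℝ) ^ c * (p : ℝ)⁻¹ ↔
      ∀ j : ℕ, j < Nat.totient (p ^ (n + 1)) → ‖PowerSeries.coeff j B‖ < (p : ℝ) ^ c := by
  have hζ := Iwasawa.isPrimitiveRoot_apply_cyclotomicGenerator κ hκ heven hord
  rw [h.mul_norm_tameGaussSum_mul_norm_le_iff_forall hα hbd (two_le_add_one_add_cyclotomicExponent n)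
    hκ heven hord]
  refine forall_congr' fun j ↦ ?_
  rw [Iwasawa.inv_lt_norm_sub_one_pow_iff hζ j]

end Layer

/-! ### §4 Stickelberger: the two conjugate Gauss sums made explicit -/

section Stickelberger

open TameBranchOneValue

variable {p : ℕ} [hp : Fact p.Prime] {N : ℕ} {f : CuspForm (Gamma0 N) 2}

/-- **Stickelberger, small exponent, for the intrinsic Gauss sum**: if `χ : (ℤ/p)^× → ℚ_p` is the
Teichmüller power of exponent `u` (`‖χ(a) − a^u‖_p < 1`) of order `e ≥ 2`, `eu = p − 1`, then for
every primitive `κ` of conductor `p^m ≥ p²`: `‖τ(ι∘χ, ψ_κ)‖^e = p^{−(e−1)}` (`ord_p τ = 1 − 1/e`).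
[cite: Lang1990, Ch. 1 §2 Thm. 2.1] -/
theorem norm_tameGaussSum_pow_eq_of_teichmullerPow {χ : MulChar (ZMod p) ℚ_[p]} {u e : ℕ}
    (hteich : ∀ a : ZMod p, a ≠ 0 → ‖χ a - ((a.val : ℕ) : ℚ_[p]) ^ u‖ < 1)
    (hχe : orderOf χ = e) (h2 : 2 ≤ e) (hu : e * u = p - 1)
    {m : ℕ} (hm : 2 ≤ m) {κ : DirichletCharacter ℂ_[p] (p ^ m)} (hκ : κ.IsPrimitive) :
    ‖tameGaussSum p (χ.ringHomComp (algebraMap ℚ_[p] ℂ_[p])) κ‖ ^ e = ((p : ℝ)⁻¹) ^ (e - 1) := by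
  rw [tameGaussSum_eq_gaussSum hm]
  exact norm_gaussSum_pow_eq_of_mul_eq hteich hχe h2 hu (isPrimitive_wildAddChar hm hκ)

/-- **Stickelberger, large exponent**: `χ` the Teichmüller power of exponent `(e−1)u` of order
`e ≥ 2`, `eu = p − 1` ⟹ `‖τ(ι∘χ, ψ_κ)‖^e = p⁻¹` (`ord_p τ = 1/e`). [cite: Lang1990, Ch. 1 §2 Thm. 2.1] -/
theorem norm_tameGaussSum_pow_eq_of_teichmullerPow' {χ : MulChar (ZMod p) ℚ_[p]} {u e : ℕ}
    (hteich : ∀ a : ZMod p, a ≠ 0 → ‖χ a - ((a.val : ℕ) : ℚ_[p]) ^ ((e - 1) * u)‖ < 1)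
    (hχe : orderOf χ = e) (h2 : 2 ≤ e) (hu : e * u = p - 1)
    {m : ℕ} (hm : 2 ≤ m) {κ : DirichletCharacter ℂ_[p] (p ^ m)} (hκ : κ.IsPrimitive) :
    ‖tameGaussSum p (χ.ringHomComp (algebraMap ℚ_[p] ℂ_[p])) κ‖ ^ e = (p : ℝ)⁻¹ := by
  rw [tameGaussSum_eq_gaussSum hm]
  exact norm_gaussSum_pow_eq_of_mul_eq' hteich hχe h2 hu (isPrimitive_wildAddChar hm hκ)

/-- `‖τ(ε,ψ_κ)‖·‖τ(ε⁻¹,ψ_κ)‖ = p⁻¹` for `ε ≠ 1` and `κ` primitive of conductor `p^m ≥ p²`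
(`τ(ε)τ(ε̄) = ε(−1)·p`, `ε(−1)² = 1`). [folklore] -/
theorem norm_tameGaussSum_mul_norm_tameGaussSum_inv {m : ℕ} (hm : 2 ≤ m)
    {ε : DirichletCharacter ℂ_[p] p} (hε : ε ≠ 1) {κ : DirichletCharacter ℂ_[p] (p ^ m)}
    (hκ : κ.IsPrimitive) :
    ‖tameGaussSum p ε κ‖ * ‖tameGaussSum p ε⁻¹ κ‖ = (p : ℝ)⁻¹ := by
  have h := congrArg (‖·‖) (tameGaussSum_mul_tameGaussSum_inv hm hε hκ)
  simp only [norm_mul] at h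
  have h1 : ‖ε (-1)‖ = 1 := by
    have hsq : ‖ε (-1)‖ * ‖ε (-1)‖ = 1 := by
      rw [← norm_mul, apply_neg_one_mul_apply_neg_one, norm_one]
    have h0 : 0 ≤ ‖ε (-1)‖ := norm_nonneg _
    nlinarith [hsq, h0]
  have hnp : ‖(p : ℂ_[p])‖ = (p : ℝ)⁻¹ := by
    rw [← map_natCast (algebraMap ℚ_[p] ℂ_[p]) p, norm_algebraMap', Padic.norm_p]
  rw [h1, hnp, one_mul] at h
  exact h

/-- **The conjugate Gauss sum**: for `χ` the Teichmüller power of exponent `u` of order `e ≥ 2`,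
`eu = p − 1`: `‖τ(ι∘χ⁻¹, ψ_κ)‖^e = p⁻¹` — the two conjugate characters of order `e ∈ {3,4,6}` have Gauss
sums of DIFFERENT absolute value (`1 − 1/e` vs `1/e`). [cite: Lang1990, Ch. 1 §2 Thm. 2.1] -/
theorem norm_tameGaussSum_inv_pow_eq_of_teichmullerPow {χ : MulChar (ZMod p) ℚ_[p]} {u e : ℕ}
    (hteich : ∀ a : ZMod p, a ≠ 0 → ‖χ a - ((a.val : ℕ) : ℚ_[p]) ^ u‖ < 1)
    (hχe : orderOf χ = e) (h2 : 2 ≤ e) (hu : e * u = p - 1)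
    {m : ℕ} (hm : 2 ≤ m) {κ : DirichletCharacter ℂ_[p] (p ^ m)} (hκ : κ.IsPrimitive) :
    ‖tameGaussSum p (χ⁻¹.ringHomComp (algebraMap ℚ_[p] ℂ_[p])) κ‖ ^ e = (p : ℝ)⁻¹ := by
  set ι := algebraMap ℚ_[p] ℂ_[p] with hι
  have hp0 : (0 : ℝ) < p := by exact_mod_cast hp.out.pos
  have hε1 : χ.ringHomComp ι ≠ 1 := by
    intro h
    have hord : orderOf (χ.ringHomComp ι) = e := by rw [orderOf_ringHomComp_padicComplex, hχe]
    rw [h, orderOf_one] at hord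
    omega
  have hprod := norm_tameGaussSum_mul_norm_tameGaussSum_inv hm hε1 hκ
  rw [MulChar.ringHomComp_inv] at hprod
  have hG := norm_tameGaussSum_pow_eq_of_teichmullerPow hteich hχe h2 hu hm hκ
  -- `‖τ(χ)‖^e · ‖τ(χ⁻¹)‖^e = p^{−e}` and `‖τ(χ)‖^e = p^{−(e−1)}`
  have hpow := congrArg (· ^ e) hprod
  simp only [mul_pow] at hpow
  rw [hG] at hpow
  have hne : ((p : ℝ)⁻¹) ^ (e - 1) ≠ 0 := pow_ne_zero _ (inv_ne_zero hp0.ne')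
  have hsplit : ((p : ℝ)⁻¹) ^ e = ((p : ℝ)⁻¹) ^ (e - 1) * (p : ℝ)⁻¹ := by
    rw [← pow_succ, Nat.sub_add_cancel (by omega : 1 ≤ e)]
  rw [hsplit] at hpow
  exact mul_left_cancel₀ hne hpow

/-- `p^e·p^{−(e−1)} = p` in `ℝ` (`e ≥ 1`). [folklore] -/
theorem pow_mul_inv_pow_sub_one {e : ℕ} (he : 1 ≤ e) :
    (p : ℝ) ^ e * ((p : ℝ)⁻¹) ^ (e - 1) = p := by
  have hp0 : (p : ℝ) ≠ 0 := Nat.cast_ne_zero.mpr hp.out.ne_zero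
  obtain ⟨e', rfl⟩ : ∃ e', e = e' + 1 := ⟨e - 1, by omega⟩
  rw [Nat.add_sub_cancel, pow_succ, mul_assoc, mul_comm (p : ℝ), ← mul_assoc, ← mul_pow,
    mul_inv_cancel₀ hp0, one_pow, one_mul]

/-- `p^e·p⁻¹ = p^{e−1}` in `ℝ` (`e ≥ 1`). [folklore] -/
theorem pow_mul_inv_eq_pow_sub_one {e : ℕ} (he : 1 ≤ e) :
    (p : ℝ) ^ e * (p : ℝ)⁻¹ = (p : ℝ) ^ (e - 1) := by
  have hp0 : (p : ℝ) ≠ 0 := Nat.cast_ne_zero.mpr hp.out.ne_zero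
  obtain ⟨e', rfl⟩ : ∃ e', e = e' + 1 := ⟨e - 1, by omega⟩
  rw [Nat.add_sub_cancel, pow_succ, mul_assoc, mul_inv_cancel₀ hp0, mul_one]

end Stickelberger

end Summit.BirchSwinnertonDyer.Rank1Residual.Additive

end
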